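import Summits.BirchSwinnertonDyer.BirchSwinnertonDyer.Theorems.Rank2Observatory2DescUnitsModSq
import HarnessLib

/-!
# BirchSwinnertonDyer — rank ≥ 2 observatory: KERNEL-2DESC-Z2, units modulo squares with a real place

HONEST FRAMING: per-curve certified theorems and census instruments; no claim on BSD in rank ≥ 2.

Generic layer of the KERNEL-2DESC-Z2 instrument (`code/b2b-bsdr2-cert-3/kernel-2desc-z2/README-Z2.md`).
The tree's `exists_isSquare_unit_mul_prod` (`Rank2Observatory2DescUnitsModSq`) turns an
independence certificate for `rank K + 1` units into "the family spans `(𝓞 K)ˣ/(𝓞 K)ˣ²`", but asks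
for ODD degree (to get torsion `= ±1`). The `ℤ/2`-torsion rows live over REAL QUADRATIC fields
`K = ℚ(√D)`; this file replaces "odd degree" by "a ring map `K →+* ℝ` exists" (a root of unity is
`±1` at a real embedding), and records `rank K = 1` for a quadratic field with a real embedding, so a
row's unit family is `(−1, ε)` with ANY unit `ε` independent of `−1` modulo squares (no claim that
`ε` is fundamental is needed). Sorry-free; axioms `propext`, `Classical.choice`, `Quot.sound`.
[cite: Marcus2018, Ch. 5 Thm. 38]
-/

-- single-conjunct summit: `Summit.BirchSwinnertonDyer.BirchSwinnertonDyer.…` repeats the name by design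
set_option linter.dupNamespace false

noncomputable section

open scoped Classical NumberField

open NumberField NumberField.Units NumberField.InfinitePlace Module
open Summit.BirchSwinnertonDyer.BirchSwinnertonDyer.Rank2Observatory.TwoDescCubic

namespace Summit.BirchSwinnertonDyer.BirchSwinnertonDyer.Rank2Observatory.TwoDescZ2

variable {K : Type*} [Field K] [NumberField K]

omit [NumberField K] in
/-- **Roots of unity are `±1` in a field with a real embedding.** [folklore] -/
theorem torsion_eq_one_or_neg_one_of_real (ρ : K →+* ℝ) (x : torsion K) :
    (x : (𝓞 K)ˣ) = 1 ∨ (x : (𝓞 K)ˣ) = -1 := by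
  set u : (𝓞 K)ˣ := (x : (𝓞 K)ˣ) with hu
  have hfin : IsOfFinOrder u := (CommGroup.mem_torsion _).1 x.2
  set n := orderOf u with hn
  have hn0 : 0 < n := hfin.orderOf_pos
  have hpow : ((u : 𝓞 K) : K) ^ n = 1 := by
    have h := pow_orderOf_eq_one u
    rw [← hn] at h
    have h2 := congrArg (fun v : (𝓞 K)ˣ ↦ ((v : 𝓞 K) : K)) h
    simpa using h2
  have hρn : (ρ ((u : 𝓞 K) : K)) ^ n = 1 := by rw [← map_pow, hpow, map_one]
  have habs : |ρ ((u : 𝓞 K) : K)| = 1 := by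
    have h := congrArg (fun r : ℝ ↦ |r|) hρn
    simp only [abs_pow, abs_one] at h
    exact (pow_eq_one_iff_of_nonneg (abs_nonneg _) hn0.ne').1 h
  have hsq : ((u : 𝓞 K) : K) ^ 2 = 1 := by
    apply ρ.injective
    rw [map_pow, ← sq_abs, habs, one_pow, map_one]
  have hsq' : (((u : 𝓞 K) : K) - 1) * (((u : 𝓞 K) : K) + 1) = 0 := by
    linear_combination hsq
  rcases mul_eq_zero.mp hsq' with h | h
  · left
    refine Units.ext (RingOfIntegers.ext ?_)
    simpa using sub_eq_zero.mp h
  · right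
    refine Units.ext (RingOfIntegers.ext ?_)
    have h' : ((u : 𝓞 K) : K) = -1 := eq_neg_of_add_eq_zero_left h
    simpa using h'

/-- **Dirichlet, modulo squares, with a real embedding**: every unit is `(−1)^s ∏ εᵢ^{eᵢ} · η²`
with `s, eᵢ ∈ {0, 1}` (tree proof of `exists_sign_fundSystem_mul_sq` with the torsion step
replaced). [cite: Marcus2018, Ch. 5 Thm. 38] -/
theorem exists_sign_fundSystem_mul_sq_of_real (ρ : K →+* ℝ) (x : (𝓞 K)ˣ) :
    ∃ k : Fin 2 × (Fin (rank K) → Fin 2), ∃ η : (𝓞 K)ˣ, x = signFundRep k * η ^ 2 := by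
  obtain ⟨⟨ζ, e⟩, hx, -⟩ := exist_unique_eq_mul_prod K x
  refine ⟨(if ((ζ : (𝓞 K)ˣ) = 1) then 0 else 1, fun i => ⟨(e i % 2).toNat, by omega⟩),
    ∏ i, fundSystem K i ^ (e i / 2), ?_⟩
  have hsplit : ∀ i, fundSystem K i ^ e i =
      fundSystem K i ^ (((⟨(e i % 2).toNat, by omega⟩ : Fin 2) : ℕ)) *
        (fundSystem K i ^ (e i / 2)) ^ 2 := by
    intro i
    rw [← zpow_natCast, ← zpow_natCast (fundSystem K i ^ (e i / 2)) 2, ← zpow_mul, ← zpow_add]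
    congr 1
    push_cast
    rw [Int.toNat_of_nonneg (Int.emod_nonneg _ two_ne_zero)]
    omega
  rw [signFundRep, ← Finset.prod_pow, mul_assoc, ← Finset.prod_mul_distrib]
  simp_rw [← hsplit]
  rcases torsion_eq_one_or_neg_one_of_real ρ ζ with hζ | hζ
  · rw [if_pos hζ]
    simp only [Fin.val_zero, pow_zero, one_mul]
    rw [hζ, one_mul] at hx
    exact hx
  · have hne : (ζ : (𝓞 K)ˣ) ≠ 1 := by
      rw [hζ]
      intro h
      have h' := congrArg (fun u : (𝓞 K)ˣ => (u : 𝓞 K)) h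
      simp only [Units.val_neg, Units.val_one] at h'
      norm_num at h'
    rw [if_neg hne]
    simp only [Fin.val_one, pow_one]
    rw [hζ] at hx
    exact hx

/-- **Units modulo squares from an independence certificate, real-embedding form**: if
`w₀, …, w_r` (`r = rank K`) have no non-empty square sub-product in `(𝓞 K)ˣ`, every unit `u` has
`IsSquare (u · ∏_{i ∈ T} w i)` for some `T`. [folklore] -/
theorem exists_isSquare_unit_mul_prod_of_real (ρ : K →+* ℝ) {m : ℕ} (hm : m = rank K + 1)
    (w : Fin m → (𝓞 K)ˣ) (hind : ∀ T : Finset (Fin m), IsSquare (∏ i ∈ T, w i) → T = ∅)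
    (u : (𝓞 K)ˣ) : ∃ T : Finset (Fin m), IsSquare (u * ∏ i ∈ T, w i) := by
  refine exists_isSquare_mul_prod_of_indep signFundRep (exists_sign_fundSystem_mul_sq_of_real ρ)
    ?_ w hind u
  simp only [Fintype.card_prod, Fintype.card_fin, Fintype.card_fun, hm, pow_succ']
  exact le_rfl

/-- **A quadratic field with a real embedding has unit rank `1`** (both places are real).
[cite: Marcus2018, Ch. 5 Thm. 38] -/
theorem rank_eq_one_of_finrank_two_real (h2 : finrank ℚ K = 2) (ρ : K →+* ℝ) : rank K = 1 := by
  have hφ : ComplexEmbedding.IsReal (Complex.ofRealHom.comp ρ) := by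
    rw [ComplexEmbedding.isReal_iff]
    ext x
    simp [ComplexEmbedding.conjugate_coe_eq]
  have hpos : 0 < nrRealPlaces K :=
    Fintype.card_pos_iff.mpr ⟨⟨InfinitePlace.mk _, isReal_mk_iff.mpr hφ⟩⟩
  have hsum := card_add_two_mul_card_eq_rank K
  rw [h2] at hsum
  rw [rank, card_eq_nrRealPlaces_add_nrComplexPlaces]
  omega

end Summit.BirchSwinnertonDyer.BirchSwinnertonDyer.Rank2Observatory.TwoDescZ2

end
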